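import Mathlib
import Summits.Ventures.PercRepro2.Defs
import Summits.Ventures.PercRepro2.Graph
import Summits.Ventures.PercRepro2.Induced
import Summits.Ventures.PercRepro2.VdBKahn
import Summits.Ventures.PercRepro2.ReimerVdBK
import Summits.Ventures.PercRepro2.ReimerVdBKRegions
import Summits.Ventures.PercRepro2.ReimerVdBKZClosed
import Summits.Ventures.PercRepro2.ReimerVdBKZReduction
import Summits.Ventures.PercRepro2.ReimerVdBKZSplit
import Summits.Ventures.PercRepro2.ReimerVdBKZRecursion
import Summits.Ventures.PercRepro2.ReimerVdBKTypeWeight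
import Summits.Ventures.PercRepro2.ReimerVdBKPairType
import Summits.Ventures.PercRepro2.ReimerVdBKCoreDown
import Summits.Ventures.PercRepro2.ReimerVdBKCoreD

/-!
# The degree-2 expansion, I: the graphs `G⁺` and `G°` and their clusters
(blind cell PercRepro2, mine-c g47; `conjectures/MINE-C.md` §55.6 (the paper lemma), §56.7)

Let `v ≠ s` be a vertex whose only edges are `e₁ = {v, u₁}` and `e₂ = {v, u₂}` (`Deg2`).  `G⁺` (`endsPlus`)
replaces the star by the edge `u₁u₂` (on `e₁`; `e₂` becomes a loop), `G°` (`endsLoop`) removes it (both edges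
loops).  THEOREMS: if the two star edges have the same colour, the clusters of `G` and `G⁺` agree off `v`
(`conn_iff_endsPlus`); if `e₁` is open and `e₂` closed, the clusters of `G` and `G°` agree off `v` and `v` is
reached iff `u₁` is (`conn_iff_endsLoop`).  Part II (`ReimerVdBKDegTwoFlip`) has the loop / flip lemmas and
the GENSYM count; part III (`ReimerVdBKDegTwoExpansion`) the expansion identity and the theorem.
-/

namespace Summit.Ventures.PercRepro2
namespace ReimerVdBK
open Classical

variable {V : Type*} {E : Type*} [Fintype E] [DecidableEq E] [Fintype V] [DecidableEq V]
variable (ends : E → Sym2 V) (s : V)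

/-! ## A vertex of degree two -/

omit [Fintype E] [DecidableEq E] [Fintype V] [DecidableEq V] in
/-- `v` has exactly the two edges `e₁ = {v, u₁}` and `e₂ = {v, u₂}` (`u₁, u₂ ≠ v`; `u₁ = u₂` allowed). -/
structure Deg2 (v u₁ u₂ : V) (e₁ e₂ : E) : Prop where
  ne : e₁ ≠ e₂
  h1 : ends e₁ = s(v, u₁)
  h2 : ends e₂ = s(v, u₂)
  hu1 : u₁ ≠ v
  hu2 : u₂ ≠ v
  other : ∀ e, e ≠ e₁ → e ≠ e₂ → v ∉ ends e

/-- `G⁺`: the star at `v` replaced by the edge `u₁u₂` (on `e₁`); `e₂` becomes a loop at `v`. -/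
def endsPlus (v u₁ u₂ : V) (e₁ e₂ : E) : E → Sym2 V :=
  Function.update (Function.update ends e₁ s(u₁, u₂)) e₂ s(v, v)

/-- `G°`: the star at `v` removed (both edges loops at `v`). -/
def endsLoop (v : V) (e₁ e₂ : E) : E → Sym2 V :=
  Function.update (Function.update ends e₁ s(v, v)) e₂ s(v, v)

section Lemmas
variable {v u₁ u₂ : V} {e₁ e₂ : E}

omit [Fintype E] [Fintype V] [DecidableEq V] in
/-- In `G⁺` the edge `e₁` is `u₁u₂`. -/
lemma endsPlus_e₁ (h : e₁ ≠ e₂) : endsPlus ends v u₁ u₂ e₁ e₂ e₁ = s(u₁, u₂) := by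
  simp [endsPlus, Function.update_of_ne h]

omit [Fintype E] [Fintype V] [DecidableEq V] in
/-- In `G⁺` the edge `e₂` is a loop at `v`. -/
lemma endsPlus_e₂ : endsPlus ends v u₁ u₂ e₁ e₂ e₂ = s(v, v) := by
  simp [endsPlus]

omit [Fintype E] [Fintype V] [DecidableEq V] in
/-- `G⁺` agrees with `G` on every other edge. -/
lemma endsPlus_other {e : E} (h1 : e ≠ e₁) (h2 : e ≠ e₂) :
    endsPlus ends v u₁ u₂ e₁ e₂ e = ends e := by
  simp [endsPlus, Function.update_of_ne h1, Function.update_of_ne h2]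

omit [Fintype E] [Fintype V] [DecidableEq V] in
/-- In `G°` the edge `e₁` is a loop at `v`. -/
lemma endsLoop_e₁ (h : e₁ ≠ e₂) : endsLoop ends v e₁ e₂ e₁ = s(v, v) := by
  simp [endsLoop, Function.update_of_ne h]

omit [Fintype E] [Fintype V] [DecidableEq V] in
/-- In `G°` the edge `e₂` is a loop at `v`. -/
lemma endsLoop_e₂ : endsLoop ends v e₁ e₂ e₂ = s(v, v) := by
  simp [endsLoop]

omit [Fintype E] [Fintype V] [DecidableEq V] in
/-- `G°` agrees with `G` on every other edge. -/
lemma endsLoop_other {e : E} (h1 : e ≠ e₁) (h2 : e ≠ e₂) : endsLoop ends v e₁ e₂ e = ends e := by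
  simp [endsLoop, Function.update_of_ne h1, Function.update_of_ne h2]

omit [Fintype E] [DecidableEq E] [Fintype V] [DecidableEq V] in
/-- The endpoints of `e₁`: an edge `e₁ = {v, u₁}` with ends `s(x, y)` has `{x, y} = {v, u₁}`. -/
lemma eq_of_ends_eq {x y a b : V} (h : s(x, y) = s(a, b)) : (x = a ∧ y = b) ∨ (x = b ∧ y = a) := by
  rw [Sym2.eq_iff] at h
  exact h

omit [Fintype E] [DecidableEq E] [Fintype V] [DecidableEq V] in
/-- A loop has equal endpoints. -/
lemma eq_of_loop {x y z : V} (h : s(z, z) = s(x, y)) : x = y := by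
  rcases Sym2.eq_iff.1 h with ⟨h1, h2⟩ | ⟨h1, h2⟩
  · exact h1.symm.trans h2
  · exact h2.symm.trans h1

omit [Fintype E] [DecidableEq E] [Fintype V] [DecidableEq V] in
/-- A vertex all of whose edges are loops is reached only by itself. -/
lemma not_conn_of_isolated {ends' : E → Sym2 V} {z : V}
    (hz : ∀ e, z ∈ ends' e → (ends' e).IsDiag) (hsz : s ≠ z) (ω : Config E) :
    ¬ Conn ends' ω s z := by
  intro h
  let S : Set V := {x | x ≠ z}
  have hS : ∀ x ∈ S, ∀ y, (openGraph ends' ω).Adj x y → y ∈ S := by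
    intro x hx y hxy hyz
    obtain ⟨hne, e, _, hends⟩ := openGraph_adj.1 hxy
    have hze : z ∈ ends' e := by rw [hends, ← hyz]; exact Sym2.mem_mk_right x y
    have := hz e hze
    rw [hends, Sym2.mk_isDiag_iff] at this
    exact hne this
  exact mem_of_conn_of_closed hS hsz h rfl

omit [Fintype E] [Fintype V] [DecidableEq V] in
/-- In `G°` the vertex `v` is isolated. -/
lemma not_conn_endsLoop (hd : Deg2 ends v u₁ u₂ e₁ e₂) (hsv : s ≠ v) (ω : Config E) :
    ¬ Conn (endsLoop ends v e₁ e₂) ω s v := by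
  apply not_conn_of_isolated s _ hsv
  intro e hve
  by_cases h1 : e = e₁
  · subst h1; rw [endsLoop_e₁ ends hd.ne]; exact Sym2.mk_isDiag_iff.2 rfl
  by_cases h2 : e = e₂
  · subst h2; rw [endsLoop_e₂]; exact Sym2.mk_isDiag_iff.2 rfl
  rw [endsLoop_other ends h1 h2] at hve
  exact absurd hve (hd.other e h1 h2)

omit [Fintype E] [Fintype V] [DecidableEq V] in
/-- In `G⁺` the vertex `v` is isolated. -/
lemma not_conn_endsPlus (hd : Deg2 ends v u₁ u₂ e₁ e₂) (hsv : s ≠ v) (ω : Config E) :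
    ¬ Conn (endsPlus ends v u₁ u₂ e₁ e₂) ω s v := by
  apply not_conn_of_isolated s _ hsv
  intro e hve
  by_cases h1 : e = e₁
  · subst h1
    rw [endsPlus_e₁ ends hd.ne] at hve ⊢
    rcases Sym2.mem_iff.1 hve with h | h
    · exact absurd h.symm hd.hu1
    · exact absurd h.symm hd.hu2
  by_cases h2 : e = e₂
  · subst h2; rw [endsPlus_e₂]; exact Sym2.mk_isDiag_iff.2 rfl
  rw [endsPlus_other ends h1 h2] at hve
  exact absurd hve (hd.other e h1 h2)

omit [Fintype E] [Fintype V] [DecidableEq V] in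
/-- **Same colour on the star**: for `w ≠ v`, `s ↔ w` in `G` iff in `G⁺` (world 1 view; the hypothesis
`ω e₁ = ω e₂`). -/
theorem conn_iff_endsPlus (hd : Deg2 ends v u₁ u₂ e₁ e₂) (hsv : s ≠ v) {ω : Config E}
    (hsame : ω e₁ = ω e₂) {w : V} (hw : w ≠ v) :
    Conn ends ω s w ↔ Conn (endsPlus ends v u₁ u₂ e₁ e₂) ω s w := by
  set ends' := endsPlus ends v u₁ u₂ e₁ e₂ with hends'
  constructor
  · intro h
    -- `S` = the `G⁺`-cluster, plus `v` when `e₁` is open and `u₁` is reached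
    let S : Set V := {x | Conn ends' ω s x ∨ (x = v ∧ ω e₁ = true ∧ Conn ends' ω s u₁)}
    have hS : ∀ x ∈ S, ∀ y, (openGraph ends ω).Adj x y → y ∈ S := by
      intro x hx y hxy
      obtain ⟨hne, e, he, hends⟩ := openGraph_adj.1 hxy
      by_cases h1 : e = e₁
      · subst h1
        rw [hd.h1] at hends
        rcases eq_of_ends_eq hends with ⟨hx1, hy1⟩ | ⟨hx1, hy1⟩
        · -- x = v, y = u₁
          subst hx1; subst hy1
          rcases hx with hx | ⟨_, _, hu⟩
          · exact absurd hx (not_conn_endsPlus ends s hd hsv ω)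
          · exact Or.inl hu
        · -- x = u₁, y = v
          subst hx1; subst hy1
          rcases hx with hx | ⟨hxv, _, _⟩
          · exact Or.inr ⟨rfl, he, hx⟩
          · exact absurd hxv hd.hu1
      by_cases h2 : e = e₂
      · subst h2
        rw [hd.h2] at hends
        have he1 : ω e₁ = true := by rw [hsame]; exact he
        have hadj : OpenAdj ends' ω u₁ u₂ := ⟨e₁, he1, by rw [hends', endsPlus_e₁ ends hd.ne]⟩
        rcases eq_of_ends_eq hends with ⟨hx1, hy1⟩ | ⟨hx1, hy1⟩
        · -- x = v, y = u₂
          subst hx1; subst hy1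
          rcases hx with hx | ⟨_, _, hu⟩
          · exact absurd hx (not_conn_endsPlus ends s hd hsv ω)
          · exact Or.inl (conn_trans hu (conn_of_openAdj hadj))
        · -- x = u₂, y = v
          subst hx1; subst hy1
          rcases hx with hx | ⟨hxv, _, _⟩
          · exact Or.inr ⟨rfl, he1, conn_trans hx (conn_of_openAdj hadj.symm)⟩
          · exact absurd hxv hd.hu2
      · -- an edge not at `v`
        have hends2 : ends' e = ends e := endsPlus_other ends h1 h2
        rcases hx with hx | ⟨hxv, _, _⟩
        · exact Or.inl (conn_trans hx (conn_of_openAdj ⟨e, he, by rw [hends2, hends]⟩))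
        · subst hxv
          exact absurd (by rw [hends]; exact Sym2.mem_mk_left _ _) (hd.other e h1 h2)
    have hs : s ∈ S := Or.inl (conn_refl _ _ _)
    rcases mem_of_conn_of_closed hS hs h with hw' | ⟨hwv, _, _⟩
    · exact hw'
    · exact absurd hwv hw
  · intro h
    -- the `G`-cluster is closed under `G⁺`-adjacency
    let S : Set V := {x | Conn ends ω s x}
    have hS : ∀ x ∈ S, ∀ y, (openGraph ends' ω).Adj x y → y ∈ S := by
      intro x hx y hxy
      obtain ⟨hne, e, he, hends⟩ := openGraph_adj.1 hxy
      by_cases h1 : e = e₁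
      · rw [h1] at he hends
        rw [hends', endsPlus_e₁ ends hd.ne] at hends
        have he2 : ω e₂ = true := by rw [← hsame]; exact he
        have ha1 : OpenAdj ends ω v u₁ := ⟨e₁, he, hd.h1⟩
        have ha2 : OpenAdj ends ω v u₂ := ⟨e₂, he2, hd.h2⟩
        rcases eq_of_ends_eq hends with ⟨hx1, hy1⟩ | ⟨hx1, hy1⟩
        · subst hx1; subst hy1
          exact conn_trans (conn_trans hx (conn_of_openAdj ha1.symm)) (conn_of_openAdj ha2)
        · subst hx1; subst hy1
          exact conn_trans (conn_trans hx (conn_of_openAdj ha2.symm)) (conn_of_openAdj ha1)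
      by_cases h2 : e = e₂
      · rw [h2] at hends
        rw [hends', endsPlus_e₂] at hends
        exact absurd (eq_of_loop hends) hne
      · have hends2 : ends' e = ends e := endsPlus_other ends h1 h2
        rw [hends2] at hends
        exact conn_trans hx (conn_of_openAdj ⟨e, he, hends⟩)
    exact mem_of_conn_of_closed hS (conn_refl _ _ _) h

omit [Fintype E] [Fintype V] [DecidableEq V] in
/-- **Different colours on the star** (`e₁` open, `e₂` closed): for `w ≠ v`, `s ↔ w` in `G` iff in
`G°`, and `s ↔ v` in `G` iff `s ↔ u₁` in `G°`. -/
theorem conn_iff_endsLoop (hd : Deg2 ends v u₁ u₂ e₁ e₂) (hsv : s ≠ v) {ω : Config E}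
    (h1o : ω e₁ = true) (h2c : ω e₂ = false) :
    (∀ w, w ≠ v → (Conn ends ω s w ↔ Conn (endsLoop ends v e₁ e₂) ω s w)) ∧
      (Conn ends ω s v ↔ Conn (endsLoop ends v e₁ e₂) ω s u₁) := by
  set ends' := endsLoop ends v e₁ e₂ with hends'
  -- the `G`-cluster sits inside `S` = the `G°`-cluster plus `v` when `u₁` is reached
  let S : Set V := {x | Conn ends' ω s x ∨ (x = v ∧ Conn ends' ω s u₁)}
  have hS : ∀ x ∈ S, ∀ y, (openGraph ends ω).Adj x y → y ∈ S := by
    intro x hx y hxy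
    obtain ⟨hne, e, he, hends⟩ := openGraph_adj.1 hxy
    by_cases h1 : e = e₁
    · subst h1
      rw [hd.h1] at hends
      rcases eq_of_ends_eq hends with ⟨hx1, hy1⟩ | ⟨hx1, hy1⟩
      · subst hx1; subst hy1
        rcases hx with hx | ⟨_, hu⟩
        · exact absurd hx (not_conn_endsLoop ends s hd hsv ω)
        · exact Or.inl hu
      · subst hx1; subst hy1
        rcases hx with hx | ⟨hxv, _⟩
        · exact Or.inr ⟨rfl, hx⟩
        · exact absurd hxv hd.hu1
    by_cases h2 : e = e₂
    · subst h2
      rw [h2c] at he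
      exact absurd he Bool.false_ne_true
    · have hends2 : ends' e = ends e := endsLoop_other ends h1 h2
      rcases hx with hx | ⟨hxv, _⟩
      · exact Or.inl (conn_trans hx (conn_of_openAdj ⟨e, he, by rw [hends2, hends]⟩))
      · subst hxv
        exact absurd (by rw [hends]; exact Sym2.mem_mk_left _ _) (hd.other e h1 h2)
  have hs : s ∈ S := Or.inl (conn_refl _ _ _)
  -- the `G°`-cluster sits inside the `G`-cluster
  have hsub : ∀ w, Conn ends' ω s w → Conn ends ω s w := by
    intro w hw
    let T : Set V := {x | Conn ends ω s x}
    have hT : ∀ x ∈ T, ∀ y, (openGraph ends' ω).Adj x y → y ∈ T := by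
      intro x hx y hxy
      obtain ⟨hne, e, he, hends⟩ := openGraph_adj.1 hxy
      by_cases h1 : e = e₁
      · rw [h1] at hends
        rw [hends', endsLoop_e₁ ends hd.ne] at hends
        exact absurd (eq_of_loop hends) hne
      by_cases h2 : e = e₂
      · rw [h2] at hends
        rw [hends', endsLoop_e₂] at hends
        exact absurd (eq_of_loop hends) hne
      · have hends2 : ends' e = ends e := endsLoop_other ends h1 h2
        rw [hends2] at hends
        exact conn_trans hx (conn_of_openAdj ⟨e, he, hends⟩)
    exact mem_of_conn_of_closed hT (conn_refl _ _ _) hw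
  refine ⟨fun w hw => ⟨fun h => ?_, hsub w⟩, ⟨fun h => ?_, fun h => ?_⟩⟩
  · rcases mem_of_conn_of_closed hS hs h with hw' | ⟨hwv, _⟩
    · exact hw'
    · exact absurd hwv hw
  · rcases mem_of_conn_of_closed hS hs h with hv' | ⟨_, hu⟩
    · exact absurd hv' (not_conn_endsLoop ends s hd hsv ω)
    · exact hu
  · exact conn_trans (hsub u₁ h) (conn_of_openAdj ⟨e₁, h1o, by rw [hd.h1, Sym2.eq_swap]⟩)

omit [Fintype E] [DecidableEq E] [Fintype V] [DecidableEq V] in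
/-- With both star edges closed, `v` is not reached. -/
lemma not_conn_of_star_closed (hd : Deg2 ends v u₁ u₂ e₁ e₂) (hsv : s ≠ v) {ω : Config E}
    (h1 : ω e₁ = false) (h2 : ω e₂ = false) : ¬ Conn ends ω s v := by
  intro h
  let S : Set V := {x | x ≠ v}
  have hS : ∀ x ∈ S, ∀ y, (openGraph ends ω).Adj x y → y ∈ S := by
    intro x hx y hxy hyv
    obtain ⟨hne, e, he, hends⟩ := openGraph_adj.1 hxy
    subst hyv
    by_cases he1 : e = e₁
    · rw [he1, h1] at he; exact Bool.false_ne_true he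
    by_cases he2 : e = e₂
    · rw [he2, h2] at he; exact Bool.false_ne_true he
    · exact hd.other e he1 he2 (by rw [hends]; exact Sym2.mem_mk_right _ _)
  exact mem_of_conn_of_closed hS hsv h rfl

omit [Fintype E] [DecidableEq E] [Fintype V] [DecidableEq V] in
/-- The degree-2 structure with the two edges swapped. -/
lemma Deg2.swap (hd : Deg2 ends v u₁ u₂ e₁ e₂) : Deg2 ends v u₂ u₁ e₂ e₁ :=
  ⟨hd.ne.symm, hd.h2, hd.h1, hd.hu2, hd.hu1, fun e h2 h1 => hd.other e h1 h2⟩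

omit [Fintype E] [Fintype V] [DecidableEq V] in
/-- `G°` does not depend on the order of the two edges. -/
lemma endsLoop_swap (h : e₁ ≠ e₂) : endsLoop ends v e₂ e₁ = endsLoop ends v e₁ e₂ := by
  unfold endsLoop
  rw [Function.update_comm h.symm]

omit [Fintype E] [DecidableEq E] [Fintype V] [DecidableEq V] in
/-- The complement of a configuration with `e₁` open and `e₂` closed has `e₂` open and `e₁` closed. -/
lemma compl_apply (ω : Config E) (e : E) : compl ω e = !ω e := rfl

end Lemmas


end ReimerVdBK
end Summit.Ventures.PercRepro2
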